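import Literature.NumberTheory.Sieve.GranvilleGoldbachSummatory
import Literature.NumberTheory.Sieve.GranvilleGoldbachMeanValue
import Literature.NumberTheory.LFunctions.VonMangoldtLaplace
import Literature.NumberTheory.LFunctions.VonKochTheorem
import HarnessLib

/-!
# Granville's Theorem 1A: `RH ↔ ∑_{N ≤ x, N even} (G(N) − J(N)) ≪ x^{3/2+o(1)}` — proof

Discharge of the named fact `Literature.NumberTheory.Sieve.granville_thm1A`
(`Literature/NumberTheory/Sieve/GranvilleGoldbach.lean`; A. Granville, *Refinements of
Goldbach's conjecture, and the generalized Riemann hypothesis*, Funct. Approx. Comment. Math.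
37 (2007), 159–173, Theorem 1A; corrigendum 38 (2008), 235–237; converse completed by
G. Bhowmik, I. Z. Ruzsa, Anal. Math. 44 (2018), 51–56):

* `Literature.NumberTheory.Sieve.granville_thm1A_holds : granville_thm1A`.

## Proof

Write `T(x) = ∑_{N ≤ x, N even} (G(N) − J(N))`, `S(x) = ∑_{N ≤ x} G(N)` (`goldbachLogSum`) and
`S_Λ(x) = ∑_{n ≤ x} ∑_{a+b=n} Λ(a)Λ(b)` (`Literature.NumberTheory.LFunctions.selfConvSum Λ`).
Two elementary comparisons reduce everything to `S` resp. `S_Λ`: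
`∑_{N ≤ x, N even} J(N) = x²/2 + O(x^{3/2})` (`abs_sum_even_goldbachHLMain_sub_le`,
`GranvilleGoldbachMeanValue.lean`; Granville p. 169: "`∑_{2n ≤ x} J(2n) = x²/2 + O(x log x)`"),
the odd `N` contribute `O(x^{3/2})` (`sum_odd_goldbachLogCount_le`), and
`0 ≤ S_Λ(x) − S(x) ≤ 2ψ(x)(ψ(x) − θ(x)) = O(x^{3/2})` (prime powers; Chebyshev's bounds from
Mathlib, `abs_selfConvSum_vonMangoldt_sub_goldbachLogSum_le`).

* (`⇒`, Granville §5 (5.2) via the explicit formula; here via von Koch's theorem) RH gives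
  `ψ(x) = x + O(√x log² x)` (`Literature.NumberTheory.LFunctions.vonKoch_chebyshevPsi_of_riemannHypothesis_holds`,
  proved in `VonKochTheorem.lean`), hence `|θ(n) − n| ≤ A (n+1)^{1/2+ε}`, hence
  `S(x) = x²/2 + O(x^{3/2+ε})` (`abs_goldbachLogSum_sub_le`, `GranvilleGoldbachSummatory.lean`),
  hence `T(x) = O(x^{3/2+ε})`.
* (`⇐`, Granville §5 with Bhowmik–Ruzsa Thm. 2.1) `T(x) = O(x^{3/2+ε})` gives
  `S_Λ(x) = x²/2 + O(x^{3/2+ε})`, hence `ζ(s) ≠ 0` for `Re s > 1/2 + ε`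
  (`Literature.NumberTheory.LFunctions.quasiRiemannHypothesis_of_selfConvSum_vonMangoldt`,
  `VonMangoldtLaplace.lean`: power series `∑ Λ(n) e^{-nt} = 1/t + O(t^{-1/2-ε})` and Mellin
  continuation of `−Γζ'/ζ`); as `ε > 0` is arbitrary, `QuasiRiemannHypothesis (1/2)`, which is RH by
  the symmetry of the zeros (`Literature.NumberTheory.LFunctions.quasiRiemannHypothesis_one_half_iff_holds`).

## References

* A. Granville, Funct. Approx. Comment. Math. 37 (2007), 159–173, Thm. 1A, §5 (5.1)–(5.2);
  corrigendum ibid. 38 (2008), 235–237.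
* G. Bhowmik, I. Z. Ruzsa, *Average Goldbach and the quasi-Riemann hypothesis*, Anal. Math. 44
  (2018), 51–56, Thm. 2.1.
* H. L. Montgomery, R. C. Vaughan, *Multiplicative Number Theory I*, CUP 2007, Thm. 13.1, §15.1.
-/

noncomputable section

open Finset Filter Asymptotics Literature.NumberTheory.LFunctions
open scoped Chebyshev ArithmeticFunction.vonMangoldt

namespace Literature.NumberTheory.Sieve

namespace GoldbachAverage

/-! ### Big-O on `ℕ` versus uniform bounds by `(x+1)^β` -/

/-- A big-O bound `f(x) = O(x^β)` on `ℕ` (`β ≥ 0`) gives a uniform bound `|f(x)| ≤ C (x+1)^β`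
with `C ≥ 0`. [folklore] -/
theorem exists_abs_le_succ_rpow_of_isBigO {f : ℕ → ℝ} {β : ℝ} (hβ : 0 ≤ β)
    (h : f =O[atTop] fun x : ℕ ↦ (x : ℝ) ^ β) :
    ∃ C, 0 ≤ C ∧ ∀ x : ℕ, |f x| ≤ C * ((x : ℝ) + 1) ^ β := by
  have h1 : f =O[atTop] fun x : ℕ ↦ ((x : ℝ) + 1) ^ β := by
    refine h.trans (IsBigO.of_bound 1 (Eventually.of_forall fun x ↦ ?_))
    rw [Real.norm_eq_abs, Real.norm_eq_abs, abs_of_nonneg (by positivity),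
      abs_of_nonneg (by positivity), one_mul]
    exact Real.rpow_le_rpow x.cast_nonneg (by linarith) hβ
  obtain ⟨C, hC⟩ := (isBigO_nat_atTop_iff (fun x hx ↦ absurd hx (by positivity))).mp h1
  refine ⟨max C 0, le_max_right _ _, fun x ↦ ?_⟩
  have hx := hC x
  rw [Real.norm_eq_abs, Real.norm_eq_abs,
    abs_of_nonneg (by positivity : (0 : ℝ) ≤ ((x : ℝ) + 1) ^ β)] at hx
  exact hx.trans (mul_le_mul_of_nonneg_right (le_max_left _ _) (by positivity))

/-- Conversely a uniform bound `|f(x)| ≤ C (x+1)^β` (`β ≥ 0`) gives `f(x) = O(x^β)` on `ℕ`.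
[folklore] -/
theorem isBigO_rpow_of_abs_le_succ_rpow {f : ℕ → ℝ} {β C : ℝ} (hβ : 0 ≤ β)
    (h : ∀ x : ℕ, |f x| ≤ C * ((x : ℝ) + 1) ^ β) : f =O[atTop] fun x : ℕ ↦ (x : ℝ) ^ β := by
  have hC : 0 ≤ C := by
    have := (abs_nonneg _).trans (h 0)
    simpa using this
  refine IsBigO.of_bound (C * 2 ^ β) ?_
  filter_upwards [eventually_ge_atTop 1] with x hx
  have hx' : (1 : ℝ) ≤ x := by exact_mod_cast hx
  rw [Real.norm_eq_abs, Real.norm_eq_abs, abs_of_nonneg (by positivity : (0 : ℝ) ≤ (x : ℝ) ^ β)]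
  calc |f x| ≤ C * ((x : ℝ) + 1) ^ β := h x
    _ ≤ C * ((2 * x) ^ β) := by gcongr; linarith
    _ = C * 2 ^ β * (x : ℝ) ^ β := by rw [Real.mul_rpow zero_le_two (by linarith)]; ring

/-- The same from a big-O bound on `ℝ`: `f(x) = O(x^β)` as `x → ∞` in `ℝ` gives
`|f(n)| ≤ C (n+1)^β` for all `n : ℕ`. [folklore] -/
theorem exists_abs_le_succ_rpow_of_isBigO_real {f : ℝ → ℝ} {β : ℝ} (hβ : 0 ≤ β)
    (h : f =O[atTop] fun x : ℝ ↦ x ^ β) :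
    ∃ C, 0 ≤ C ∧ ∀ n : ℕ, |f n| ≤ C * ((n : ℝ) + 1) ^ β :=
  exists_abs_le_succ_rpow_of_isBigO hβ h.natCast_atTop

/-! ### `S_Λ` versus `S`: the prime powers -/

/-- `S_Λ(x) = ∑_{n ≤ x} ∑_{a+b=n} Λ(a)Λ(b)` collected by `a`: `= ∑_{a ≤ x} Λ(a) ψ(x − a)`. [folklore] -/
theorem selfConvSum_vonMangoldt_eq (x : ℕ) :
    selfConvSum (fun n ↦ Λ n) x = ∑ a ∈ range (x + 1), Λ a * ψ ((x - a : ℕ) : ℝ) := by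
  simp_rw [selfConvSum_def, selfConv_def, psi_natCast]
  exact sum_range_sum_antidiagonal (fun n ↦ Λ n) (fun n ↦ Λ n) x

/-- `ψ(n) − θ(n) = ∑_{k ≤ n} (Λ(k) − Λ'(k))` at natural arguments. [folklore] -/
theorem psi_sub_theta_natCast (n : ℕ) :
    ψ (n : ℝ) - θ (n : ℝ) = ∑ k ∈ range (n + 1), (Λ k - vonMangoldtPrime k) := by
  rw [psi_natCast, theta_natCast, sum_sub_distrib]

/-- `ψ(m) − θ(m) ≤ ψ(n) − θ(n)` for `m ≤ n` (a sum of the non-negative `Λ − Λ'`). [folklore] -/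
theorem psi_sub_theta_mono {m n : ℕ} (h : m ≤ n) :
    ψ (m : ℝ) - θ (m : ℝ) ≤ ψ (n : ℝ) - θ (n : ℝ) := by
  rw [psi_sub_theta_natCast, psi_sub_theta_natCast]
  exact sum_le_sum_of_subset_of_nonneg (range_subset_range.mpr (by omega))
    fun k _ _ ↦ sub_nonneg.mpr (vonMangoldtPrime_le_vonMangoldt k).2

/-- **`S_Λ(x) − S(x)`**: `0 ≤ S_Λ(x) − S(x) ≤ 2 ψ(x) (ψ(x) − θ(x))`, since
`Λ(a)Λ(b) − Λ'(a)Λ'(b) = (Λ−Λ')(a)Λ(b) + Λ'(a)(Λ−Λ')(b)` and `ψ`, `ψ − θ` are monotone.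
[folklore] -/
theorem selfConvSum_vonMangoldt_sub_goldbachLogSum (x : ℕ) :
    0 ≤ selfConvSum (fun n ↦ Λ n) x - goldbachLogSum x ∧
      selfConvSum (fun n ↦ Λ n) x - goldbachLogSum x ≤ 2 * ψ x * (ψ x - θ x) := by
  have hdec : selfConvSum (fun n ↦ Λ n) x - goldbachLogSum x =
      ∑ a ∈ range (x + 1), (Λ a - vonMangoldtPrime a) * ψ ((x - a : ℕ) : ℝ) +
        ∑ a ∈ range (x + 1), vonMangoldtPrime a * (ψ ((x - a : ℕ) : ℝ) - θ ((x - a : ℕ) : ℝ)) := by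
    simp_rw [psi_sub_theta_natCast, psi_natCast, ← sum_range_sum_antidiagonal, ← sum_add_distrib,
      selfConvSum_def, selfConv_def, goldbachLogSum_def, goldbachLogCount_eq_sum_vonMangoldtPrime,
      ← sum_sub_distrib]
    refine sum_congr rfl fun N _ ↦ sum_congr rfl fun ab _ ↦ by ring
  have hΛ' := vonMangoldtPrime_le_vonMangoldt
  have hx0 : (0 : ℝ) ≤ x := x.cast_nonneg
  constructor
  · rw [hdec]
    refine add_nonneg (sum_nonneg fun a _ ↦ mul_nonneg (sub_nonneg.mpr (hΛ' a).2)
      (Chebyshev.psi_nonneg _)) (sum_nonneg fun a _ ↦ mul_nonneg (hΛ' a).1 ?_)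
    exact sub_nonneg.mpr (Chebyshev.theta_le_psi _)
  · rw [hdec]
    have hxa : ∀ a ∈ range (x + 1), ((x - a : ℕ) : ℝ) ≤ x := fun a _ ↦ by
      exact_mod_cast Nat.sub_le x a
    have h1 : ∑ a ∈ range (x + 1), (Λ a - vonMangoldtPrime a) * ψ ((x - a : ℕ) : ℝ) ≤
        (ψ x - θ x) * ψ x := by
      calc ∑ a ∈ range (x + 1), (Λ a - vonMangoldtPrime a) * ψ ((x - a : ℕ) : ℝ)
          ≤ ∑ a ∈ range (x + 1), (Λ a - vonMangoldtPrime a) * ψ x :=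
            sum_le_sum fun a ha ↦ mul_le_mul_of_nonneg_left (Chebyshev.psi_mono (hxa a ha))
              (sub_nonneg.mpr (hΛ' a).2)
        _ = (ψ x - θ x) * ψ x := by rw [← sum_mul, ← psi_sub_theta_natCast]
    have h2 : ∑ a ∈ range (x + 1), vonMangoldtPrime a * (ψ ((x - a : ℕ) : ℝ) - θ ((x - a : ℕ) : ℝ)) ≤
        θ x * (ψ x - θ x) := by
      calc ∑ a ∈ range (x + 1), vonMangoldtPrime a * (ψ ((x - a : ℕ) : ℝ) - θ ((x - a : ℕ) : ℝ))
          ≤ ∑ a ∈ range (x + 1), vonMangoldtPrime a * (ψ x - θ x) :=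
            sum_le_sum fun a _ ↦ mul_le_mul_of_nonneg_left (psi_sub_theta_mono (Nat.sub_le x a))
              (hΛ' a).1
        _ = θ x * (ψ x - θ x) := by rw [← sum_mul, ← theta_natCast]
    have h3 : θ (x : ℝ) ≤ ψ x := Chebyshev.theta_le_psi _
    have h4 : 0 ≤ ψ (x : ℝ) - θ x := sub_nonneg.mpr h3
    nlinarith

/-- `|S_Λ(x) − S(x)| ≤ C (x+1)^{3/2}` with an absolute constant (Chebyshev: `ψ(x) ≤ (log 4 + 4) x`,
`ψ(x) − θ(x) ≤ C₀ √x`, Mathlib). [folklore] -/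
theorem exists_abs_selfConvSum_vonMangoldt_sub_goldbachLogSum_le :
    ∃ C, 0 ≤ C ∧ ∀ x : ℕ,
      |selfConvSum (fun n ↦ Λ n) x - goldbachLogSum x| ≤ C * ((x : ℝ) + 1) ^ (3 / 2 : ℝ) := by
  obtain ⟨C₀, hC₀⟩ := Chebyshev.psi_sub_theta_le_mul_sqrt
  have hC₀' : 0 ≤ C₀ := by
    have h := hC₀ 4
    have h4 : 0 < ψ 4 - θ 4 := by
      rw [Chebyshev.psi_sub_theta_eq_sum_not_prime]
      refine sum_pos' (fun n _ ↦ ArithmeticFunction.vonMangoldt_nonneg) ⟨4, ?_, ?_⟩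
      · simp only [Nat.floor_ofNat, mem_filter, mem_Ioc]; decide
      · rw [ArithmeticFunction.vonMangoldt_apply]
        have : IsPrimePow 4 := ⟨2, 2, Nat.prime_two.prime, by norm_num⟩
        rw [if_pos this]
        exact Real.log_pos (by exact_mod_cast (Nat.minFac_prime (by norm_num)).one_lt)
    have : (0 : ℝ) < C₀ * Real.sqrt 4 := h4.trans_le h
    exact le_of_lt (pos_of_mul_pos_left this (Real.sqrt_nonneg _))
  refine ⟨2 * (Real.log 4 + 4) * C₀, by positivity, fun x ↦ ?_⟩
  obtain ⟨h0, h1⟩ := selfConvSum_vonMangoldt_sub_goldbachLogSum x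
  have hx0 : (0 : ℝ) ≤ x := x.cast_nonneg
  have hψ := Chebyshev.psi_le_const_mul_self hx0
  have hψθ := hC₀ x
  have hψθ0 : 0 ≤ ψ (x : ℝ) - θ x := sub_nonneg.mpr (Chebyshev.theta_le_psi _)
  rw [abs_of_nonneg h0]
  have hx32 : (x : ℝ) * Real.sqrt x ≤ ((x : ℝ) + 1) ^ (3 / 2 : ℝ) := by
    have hx1 : (0 : ℝ) < (x : ℝ) + 1 := by positivity
    rw [show (3 / 2 : ℝ) = 1 + 1 / 2 by norm_num, Real.rpow_add hx1, Real.rpow_one,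
      ← Real.sqrt_eq_rpow]
    exact mul_le_mul (by linarith) (Real.sqrt_le_sqrt (by linarith)) (Real.sqrt_nonneg _)
      (by linarith)
  calc selfConvSum (fun n ↦ Λ n) x - goldbachLogSum x ≤ 2 * ψ x * (ψ x - θ x) := h1
    _ ≤ 2 * ((Real.log 4 + 4) * x) * (C₀ * Real.sqrt x) :=
        mul_le_mul (mul_le_mul_of_nonneg_left hψ zero_le_two) hψθ hψθ0 (by positivity)
    _ = 2 * (Real.log 4 + 4) * C₀ * ((x : ℝ) * Real.sqrt x) := by ring
    _ ≤ 2 * (Real.log 4 + 4) * C₀ * ((x : ℝ) + 1) ^ (3 / 2 : ℝ) := by gcongr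

/-! ### `T(x) = ∑_{N ≤ x, N even} (G(N) − J(N))` versus `S(x) − x²/2` -/

/-- The decomposition `T(x) = (S(x) − x²/2) − ∑_{odd} G − (∑_{even} J − x²/2)`. [folklore] -/
theorem sum_even_sub_eq (x : ℕ) :
    ∑ N ∈ (range (x + 1)).filter Even, (goldbachLogCount N - goldbachHLMain N) =
      (goldbachLogSum x - (x : ℝ) ^ 2 / 2) - ∑ N ∈ (range (x + 1)).filter Odd, goldbachLogCount N -
        (∑ N ∈ (range (x + 1)).filter Even, goldbachHLMain N - (x : ℝ) ^ 2 / 2) := by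
  rw [sum_sub_distrib, sum_even_goldbachLogCount_eq]
  ring

/-- `|T(x) − (S(x) − x²/2)| ≤ (4 log 2 + 6 K₀) (x+1)^{3/2}`. [folklore] -/
theorem abs_sum_even_sub_sub_le (x : ℕ) :
    |∑ N ∈ (range (x + 1)).filter Even, (goldbachLogCount N - goldbachHLMain N) -
        (goldbachLogSum x - (x : ℝ) ^ 2 / 2)| ≤
      (4 * Real.log 2 + 6 * goldbachWeightConst) * ((x : ℝ) + 1) ^ (3 / 2 : ℝ) := by
  rw [sum_even_sub_eq]
  have h1 := sum_odd_goldbachLogCount_le x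
  have h2 := sum_odd_goldbachLogCount_nonneg x
  have h3 := abs_sum_even_goldbachHLMain_sub_le x
  rw [abs_le] at h3 ⊢
  constructor <;> nlinarith [h3.1, h3.2]

/-! ### The forward direction -/

/-- **RH `⇒ T(x) = O(x^{3/2+ε})`** (Granville §5, (5.2) `⇒` Thm. 1A; here from von Koch's
`ψ(x) = x + O(√x log² x)`, proved in the tree, via `S(x) = x²/2 + O(x^{3/2+ε})`).
[cite: Granville2007, §5 (5.2) and Thm. 1A] -/
theorem isBigO_sum_even_of_riemannHypothesis (hRH : RiemannHypothesis) {ε : ℝ} (hε : 0 < ε) :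
    (fun x : ℕ ↦ ∑ N ∈ (range (x + 1)).filter Even, (goldbachLogCount N - goldbachHLMain N))
      =O[atTop] fun x : ℕ ↦ (x : ℝ) ^ (3 / 2 + ε) := by
  have hψ := vonKoch_chebyshevPsi_of_riemannHypothesis_holds hRH
  have hθ := chebyshevTheta_isBigO_iff_chebyshevPsi_isBigO.mpr hψ
  have hθε := isBigO_rpow_of_isBigO_rpow_half_mul_log_sq hθ hε
  obtain ⟨A, hA0, hA⟩ := exists_abs_le_succ_rpow_of_isBigO_real (by linarith) hθε
  have hS := abs_goldbachLogSum_sub_le hA0 (by linarith : (0 : ℝ) ≤ 1 / 2 + ε) hA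
  have hK : 0 ≤ goldbachWeightConst := (Real.exp_pos _).le
  refine isBigO_rpow_of_abs_le_succ_rpow (C := A * Real.log 4 + A + 1 +
    (4 * Real.log 2 + 6 * goldbachWeightConst)) (by linarith) fun x ↦ ?_
  have hx1 : (1 : ℝ) ≤ (x : ℝ) + 1 := by linarith [(x.cast_nonneg : (0 : ℝ) ≤ x)]
  have hpow : ((x : ℝ) + 1) ^ (3 / 2 : ℝ) ≤ ((x : ℝ) + 1) ^ (3 / 2 + ε) :=
    Real.rpow_le_rpow_of_exponent_le hx1 (by linarith)
  have h1 := hS x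
  rw [show (1 / 2 + ε + 1 : ℝ) = 3 / 2 + ε by ring] at h1
  have h2 := abs_sum_even_sub_sub_le x
  have hl2 : 0 ≤ Real.log 2 := Real.log_nonneg (by norm_num)
  calc |∑ N ∈ (range (x + 1)).filter Even, (goldbachLogCount N - goldbachHLMain N)|
      ≤ |∑ N ∈ (range (x + 1)).filter Even, (goldbachLogCount N - goldbachHLMain N) -
          (goldbachLogSum x - (x : ℝ) ^ 2 / 2)| + |goldbachLogSum x - (x : ℝ) ^ 2 / 2| := by
        have := abs_add_le (∑ N ∈ (range (x + 1)).filter Even,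
          (goldbachLogCount N - goldbachHLMain N) - (goldbachLogSum x - (x : ℝ) ^ 2 / 2))
          (goldbachLogSum x - (x : ℝ) ^ 2 / 2)
        rwa [sub_add_cancel] at this
    _ ≤ (4 * Real.log 2 + 6 * goldbachWeightConst) * ((x : ℝ) + 1) ^ (3 / 2 : ℝ) +
          (A * Real.log 4 + A + 1) * ((x : ℝ) + 1) ^ (3 / 2 + ε) := add_le_add h2 h1
    _ ≤ (4 * Real.log 2 + 6 * goldbachWeightConst) * ((x : ℝ) + 1) ^ (3 / 2 + ε) +
          (A * Real.log 4 + A + 1) * ((x : ℝ) + 1) ^ (3 / 2 + ε) := by gcongr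
    _ = (A * Real.log 4 + A + 1 + (4 * Real.log 2 + 6 * goldbachWeightConst)) *
          ((x : ℝ) + 1) ^ (3 / 2 + ε) := by ring

/-! ### The converse direction -/

/-- **`T(x) = O(x^{3/2+ε})` `⇒ ζ(s) ≠ 0` for `1/2 + ε < Re s < 1`** (Granville §5 with
Bhowmik–Ruzsa Thm. 2.1): the hypothesis gives `S_Λ(x) = x²/2 + O(x^{3/2+ε})`, and
`Literature.NumberTheory.LFunctions.quasiRiemannHypothesis_of_selfConvSum_vonMangoldt` applies
with `α = 3/2 + ε`. [cite: Granville2007, §5 (5.2) and Thm. 1A] -/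
theorem quasiRiemannHypothesis_of_isBigO_sum_even {ε : ℝ} (hε : 0 < ε)
    (h : (fun x : ℕ ↦ ∑ N ∈ (range (x + 1)).filter Even, (goldbachLogCount N - goldbachHLMain N))
      =O[atTop] fun x : ℕ ↦ (x : ℝ) ^ (3 / 2 + ε)) :
    QuasiRiemannHypothesis (1 / 2 + ε) := by
  obtain ⟨C, hC0, hC⟩ := exists_abs_le_succ_rpow_of_isBigO (by linarith) h
  obtain ⟨C₁, hC₁0, hC₁⟩ := exists_abs_selfConvSum_vonMangoldt_sub_goldbachLogSum_le
  have hK : 0 ≤ goldbachWeightConst := (Real.exp_pos _).le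
  have hl2 : 0 ≤ Real.log 2 := Real.log_nonneg (by norm_num)
  have hSΛ : ∀ n : ℕ, |selfConvSum (fun n ↦ Λ n) n - (n : ℝ) ^ 2 / 2| ≤
      (C + (4 * Real.log 2 + 6 * goldbachWeightConst) + C₁) * ((n : ℝ) + 1) ^ (3 / 2 + ε) := by
    intro x
    have hx1 : (1 : ℝ) ≤ (x : ℝ) + 1 := by linarith [(x.cast_nonneg : (0 : ℝ) ≤ x)]
    have hpow : ((x : ℝ) + 1) ^ (3 / 2 : ℝ) ≤ ((x : ℝ) + 1) ^ (3 / 2 + ε) :=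
      Real.rpow_le_rpow_of_exponent_le hx1 (by linarith)
    have h1 := hC x
    have h2 := abs_sum_even_sub_sub_le x
    have h3 := hC₁ x
    calc |selfConvSum (fun n ↦ Λ n) x - (x : ℝ) ^ 2 / 2|
        = |(selfConvSum (fun n ↦ Λ n) x - goldbachLogSum x) +
            (-(∑ N ∈ (range (x + 1)).filter Even, (goldbachLogCount N - goldbachHLMain N) -
              (goldbachLogSum x - (x : ℝ) ^ 2 / 2))) +
            ∑ N ∈ (range (x + 1)).filter Even, (goldbachLogCount N - goldbachHLMain N)| := by
          ring_nf
      _ ≤ |selfConvSum (fun n ↦ Λ n) x - goldbachLogSum x| +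
            |(-(∑ N ∈ (range (x + 1)).filter Even, (goldbachLogCount N - goldbachHLMain N) -
              (goldbachLogSum x - (x : ℝ) ^ 2 / 2)))| +
            |∑ N ∈ (range (x + 1)).filter Even, (goldbachLogCount N - goldbachHLMain N)| :=
          (abs_add_le _ _).trans (add_le_add (abs_add_le _ _) le_rfl)
      _ ≤ C₁ * ((x : ℝ) + 1) ^ (3 / 2 : ℝ) +
            (4 * Real.log 2 + 6 * goldbachWeightConst) * ((x : ℝ) + 1) ^ (3 / 2 : ℝ) +
            C * ((x : ℝ) + 1) ^ (3 / 2 + ε) := by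
          rw [abs_neg]
          exact add_le_add (add_le_add h3 h2) h1
      _ ≤ C₁ * ((x : ℝ) + 1) ^ (3 / 2 + ε) +
            (4 * Real.log 2 + 6 * goldbachWeightConst) * ((x : ℝ) + 1) ^ (3 / 2 + ε) +
            C * ((x : ℝ) + 1) ^ (3 / 2 + ε) := by gcongr
      _ = (C + (4 * Real.log 2 + 6 * goldbachWeightConst) + C₁) * ((x : ℝ) + 1) ^ (3 / 2 + ε) := by
          ring
  have := quasiRiemannHypothesis_of_selfConvSum_vonMangoldt (by linarith) hSΛ
  rwa [show (3 / 2 + ε - 1 : ℝ) = 1 / 2 + ε by ring] at this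

/-- **`(∀ ε > 0, T(x) = O(x^{3/2+ε})) ⇒` RH**: no zeros with `Re s > 1/2 + ε` for every `ε > 0`
means `QuasiRiemannHypothesis (1/2)`, which is RH by the functional equation
(`Literature.NumberTheory.LFunctions.quasiRiemannHypothesis_one_half_iff_holds`).
[cite: Granville2007, Thm. 1A] -/
theorem riemannHypothesis_of_isBigO_sum_even
    (h : ∀ ε : ℝ, 0 < ε →
      (fun x : ℕ ↦ ∑ N ∈ (range (x + 1)).filter Even, (goldbachLogCount N - goldbachHLMain N))
        =O[atTop] fun x : ℕ ↦ (x : ℝ) ^ (3 / 2 + ε)) :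
    RiemannHypothesis := by
  refine quasiRiemannHypothesis_one_half_iff_holds.mp fun s hs h1 h2 ↦ ?_
  have hε : 0 < (s.re - 1 / 2) / 2 := by linarith
  exact quasiRiemannHypothesis_of_isBigO_sum_even hε (h _ hε) s hs (by linarith) h2

end GoldbachAverage

/-- **Granville's Theorem 1A** (A. Granville, *Refinements of Goldbach's conjecture, and the
generalized Riemann hypothesis*, Funct. Approx. Comment. Math. 37 (2007), 159–173, Thm. 1A;
corrigendum 38 (2008), 235–237; the converse completed by G. Bhowmik, I. Z. Ruzsa, Anal. Math. 44
(2018), Thm. 2.1): the Riemann Hypothesis is equivalent to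
`∑_{N ≤ x, N even} (G(N) − J(N)) = O(x^{3/2+ε})` for every `ε > 0`. Discharge of the named fact
`Literature.NumberTheory.Sieve.granville_thm1A`. [cite: Granville2007, Thm. 1A] -/
theorem granville_thm1A_holds : granville_thm1A :=
  ⟨fun hRH _ε hε ↦ GoldbachAverage.isBigO_sum_even_of_riemannHypothesis hRH hε,
    GoldbachAverage.riemannHypothesis_of_isBigO_sum_even⟩

end Literature.NumberTheory.Sieve

end
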